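import Summits.BirchSwinnertonDyer.BirchSwinnertonDyer.Theorems.PrintCf2RamifiedOffTYZSelmerRankOneMover
import HarnessLib

/-!
# Crux `PrintCf2.RamifiedOffTYZOfFacts` (stmt-BirchSwinnertonDyer-20509), line `offtyz-v7`, LEAD cycle 11 (cruxlead-20509 g10), part 4:
# LAYER-1 SILENCE — on the `s ≥ 2` classes of `n ≡ 5 (mod 8)` EVERY SQUARE OF `Gal(ℍ′_n/ℚ)` FIXES THE GENUS POINT `P(n)`

THEOREMS ONLY (no `def`, no named fact, no `sorry`), `--supports stmt-BirchSwinnertonDyer-20509`.  HONEST FRAMING: same hypotheses as the LEAD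
g7 mover criterion `MoverAssembly.sqMover_iff_sum_blocks` (the printed recursion and sign choices of `𝓛`; the CM-point layer, the conductor-2
ring class dictionary and the Frobenius clause on every block, displayed on `D : GenusPointData n`; Tian–Yuan–Zhang Thm 1.1 as the named fact
`thm11_parity_of_scriptL`) — and Monsky's `2`-Selmer formula, a tree THEOREM (`monsky_card_selmerGroup_two_odd_holds`).  Nothing is asserted; BSD
is not proved by any of this; no class is closed.

THE STATEMENT (`galPt_sq_genusPoint_eq_of_four_dvd_card_ker`, `…_of_card_selmer`): let `n = p₁⋯p_k ≡ 5 (mod 8)` be square-free with Monsky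
kernel of order divisible by `4` — equivalently `#Sel₂(E_n/ℚ) = 2^{2+s}` with `s ≥ 2`, e.g. the JUMP-ONE class `#Sel₂ = 2⁵` of C⁺ (item 23431) and
the whole B-locus.  Then **for every `g ∈ Gal(ℍ′_n/ℚ)`, `g²·P(n) = P(n)`** — exactly, not modulo torsion.

WHY (the structural reason the Layer-1 mover engine of cycles 5–10 is blind at `s = 3`, recorded as a kernel theorem): g7's criterion says
`g²` moves `P(n)` iff the block sum `B(x(g)) = Σ_{S adm} w_S (1 + x_i + Σ_{j∈S} x_j)(Σ_{j∈S} ρ_{S,j} x_j)` is `1`, where `x_j = [g moves i√−p_j]`,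
`x_i = [g moves i]`; §2 expands `B(x) = (1 + x_i)·Σ_j Ω_jj x_j + Σ_{a,b} Ω_ba x_a x_b` with g5's `Ω = QForm.Omega p`; the PROVED Q-form identity (★)
(g6/g7, `qFormIdentityOmega`) gives `Ω_jj = κB_j` and `Ω_ab + Ω_ba = (κA+κB)_a + (κA+κB)_b` with `κ = QForm.kappa p = Σ_{v ∈ ker M_n} v` the SUM
of Monsky's kernel; and (§1) the sum of all vectors of an `𝔽₂`-space of order divisible by `4` is `0`.  So at `s ≥ 2`: `κ = 0`, `Ω` is symmetric
with zero diagonal, `B ≡ 0` (the pairing `(a,b) ↔ (b,a)`, `Finset.sum_involution`), and no square moves `P(n)`.  In particular the door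
«a mover `g` of `P(n)` fixing `i`, `√−n` ⟹ `4 ∤ 𝓛(n)`» (g4, `GaloisMotion.not_four_dvd_of_galPt_genusPoint_ne`) can never be entered through a
SQUARE on the `s = 3` class: the upper half of C⁺ is not a Layer-1 statement.  (Consistent with BSD: on the B-locus `4 ∣ 𝓛(n)` forces every such
`g` to fix `P(n)`; on the G-locus no square mover exists either.)

References: [cite: TianYuanZhang2017, §3.1 (p0011 L53–L73), Prop. 3.2 (1), Thm. 3.6 (1), proof of Lemma 3.21 (p0020 L27–L63), Thm. 1.1];
[cite: HeathBrown1994SelmerCongruentII, Appendix (Monsky), typescript p. 39 L10–L41]; [cite: Smith2016CongruentDensity, Thm. 1.2]; tree: g7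
`…SelmerRankOneMover` / `…MoverSumBlocks` (`sqMover_iff_sum_blocks`), g6/g7 `…QFormIdentity` (`qFormIdentityOmega`), `…MoverParity`
(`card_ker_mulVec_eq_pow`), `Literature/…/CongruentNumberOddMonskySelmerExact` (`monsky_card_selmerGroup_two_odd_holds`).
-/

noncomputable section

open scoped Classical NumberField

open WeierstrassCurve WeierstrassCurve.Affine Finset Matrix Literature.NumberTheory.EllipticCurves
  Literature.NumberTheory.EllipticCurves.TianYuanZhang2017
  Literature.NumberTheory.EllipticCurves.TianYuanZhang2017.W2
  Literature.NumberTheory.EllipticCurves.HeathBrown1994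
  Literature.NumberTheory.EllipticCurves.Smith2016
  Literature.NumberTheory.QuadraticFields.RingClass
  Literature.NumberTheory.QuadraticFields
  Summit.BirchSwinnertonDyer.PrintCf2.QForm
  Summit.BirchSwinnertonDyer.PrintCf2.QFormForest
  Summit.BirchSwinnertonDyer.PrintCf2.MoverAssembly

set_option autoImplicit false

namespace Summit.BirchSwinnertonDyer.PrintCf2.LayerOneSilence

/-! ## §1 Linear algebra over `𝔽₂`: the sum of a kernel of order divisible by `4` vanishes -/

section F2

variable {m : Type*} [Fintype m] [DecidableEq m]

/-- `kerSum M = Σ_{v ∈ ker M} v` read on the kernel subtype. [folklore] -/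
theorem kerSum_eq_sum_subtype (M : Matrix m m (ZMod 2)) :
    kerSum M = ∑ v : {v : m → ZMod 2 // M *ᵥ v = 0}, (v : m → ZMod 2) := by
  rw [kerSum, ← Finset.sum_filter]
  exact Finset.sum_subtype _ (fun v => by simp) _

/-- **The sum of all vectors of the kernel vanishes coordinatewise when `4 ∣ #ker`**: translation by a kernel vector `v₀` with `v₀ i = 1` is a
bijection of the kernel exchanging `{v i = 1}` and `{v i = 0}`, so `#{v ∈ ker : v i = 1} = #ker / 2` is even. [folklore] -/
theorem sum_ker_apply_eq_zero (M : Matrix m m (ZMod 2)) (h4 : 4 ∣ Fintype.card {v : m → ZMod 2 // M *ᵥ v = 0}) (i : m) :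
    (∑ v : {v : m → ZMod 2 // M *ᵥ v = 0}, (v : m → ZMod 2) i) = 0 := by
  by_cases h0 : ∀ v : {v : m → ZMod 2 // M *ᵥ v = 0}, (v : m → ZMod 2) i = 0
  · exact Finset.sum_eq_zero fun v _ => h0 v
  push Not at h0
  obtain ⟨v₀, hv₀⟩ := h0
  have hv₀1 : (v₀ : m → ZMod 2) i = 1 := ((by decide : ∀ a : ZMod 2, a = 0 ∨ a = 1) _).resolve_left hv₀
  -- translation by `v₀` on the kernel
  have hadd : ∀ v : {v : m → ZMod 2 // M *ᵥ v = 0}, M *ᵥ ((v : m → ZMod 2) + v₀) = 0 := fun v => by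
    rw [Matrix.mulVec_add, v.2, v₀.2, add_zero]
  let τ : {v : m → ZMod 2 // M *ᵥ v = 0} → {v : m → ZMod 2 // M *ᵥ v = 0} := fun v => ⟨(v : m → ZMod 2) + v₀, hadd v⟩
  have hτ : ∀ v, ((τ v : {v : m → ZMod 2 // M *ᵥ v = 0}) : m → ZMod 2) = (v : m → ZMod 2) + v₀ := fun v => rfl
  have hττ : ∀ v, τ (τ v) = v := by
    intro v
    apply Subtype.ext
    rw [hτ, hτ, add_assoc, show (v₀ : m → ZMod 2) + v₀ = 0 from funext fun j => CharTwo.add_self_eq_zero _, add_zero]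
  have hτinj : Function.Injective τ := Function.LeftInverse.injective hττ
  -- the sum as the count of `{v : v i = 1}`
  have hsum : (∑ v : {v : m → ZMod 2 // M *ᵥ v = 0}, (v : m → ZMod 2) i) =
      ∑ v : {v : m → ZMod 2 // M *ᵥ v = 0}, (if (v : m → ZMod 2) i = 1 then (1 : ZMod 2) else 0) := by
    refine Finset.sum_congr rfl fun v _ => ?_
    rcases (by decide : ∀ a : ZMod 2, a = 0 ∨ a = 1) ((v : m → ZMod 2) i) with h | h <;> simp [h]
  rw [hsum, Finset.sum_boole]
  -- `#{v i = 1} = #{v i = 0}` via `τ`, so `2 · #{v i = 1} = #ker`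
  have himage : (univ.filter (fun v : {v : m → ZMod 2 // M *ᵥ v = 0} => (v : m → ZMod 2) i = 1)).image τ =
      univ.filter (fun v : {v : m → ZMod 2 // M *ᵥ v = 0} => ¬ (v : m → ZMod 2) i = 1) := by
    ext w
    simp only [mem_image, mem_filter, mem_univ, true_and]
    constructor
    · rintro ⟨v, hv, rfl⟩
      rw [hτ, Pi.add_apply, hv, hv₀1]; decide
    · intro hw
      refine ⟨τ w, ?_, hττ w⟩
      rw [hτ, Pi.add_apply, ((by decide : ∀ a : ZMod 2, a = 0 ∨ a = 1) _).resolve_right hw, hv₀1]; decide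
  have hcardeq : (univ.filter (fun v : {v : m → ZMod 2 // M *ᵥ v = 0} => (v : m → ZMod 2) i = 1)).card =
      (univ.filter (fun v : {v : m → ZMod 2 // M *ᵥ v = 0} => ¬ (v : m → ZMod 2) i = 1)).card := by
    rw [← himage, Finset.card_image_of_injective _ hτinj]
  have hpart := Finset.card_filter_add_card_filter_not (s := (univ : Finset {v : m → ZMod 2 // M *ᵥ v = 0}))
    (fun v => (v : m → ZMod 2) i = 1)
  rw [Finset.card_univ] at hpart
  obtain ⟨c, hc⟩ := h4
  have h2 : (univ.filter (fun v : {v : m → ZMod 2 // M *ᵥ v = 0} => (v : m → ZMod 2) i = 1)).card = 2 * c := by omega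
  rw [h2, Nat.cast_mul, show ((2 : ℕ) : ZMod 2) = 0 by decide, zero_mul]

/-- **`4 ∣ #ker M ⟹ kerSum M = 0`.** [folklore] -/
theorem kerSum_eq_zero_of_four_dvd (M : Matrix m m (ZMod 2)) (h4 : 4 ∣ Fintype.card {v : m → ZMod 2 // M *ᵥ v = 0}) :
    kerSum M = 0 := by
  rw [kerSum_eq_sum_subtype]
  funext i
  rw [Finset.sum_apply]
  exact sum_ker_apply_eq_zero M h4 i

end F2

/-! ## §2 Monsky's kernel sum vanishes for `s(n) ≥ 2` -/

section Kappa

variable {k : ℕ} (p : Fin k → ℕ) (hp : ∀ i, (p i).Prime) (hodd : ∀ i, Odd (p i)) (hinj : Function.Injective p)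

include hp hodd hinj in
/-- **`#Sel₂(E_n) = 2^{2+s}`, `s ≥ 2` ⟹ `#ker M_n = 2^s` is divisible by `4`** (Monsky's exact formula, tree theorem, + rank–nullity).
[cite: HeathBrown1994SelmerCongruentII, Appendix (Monsky), typescript p. 39 L27–L33] -/
theorem four_dvd_card_ker_of_card_selmer {s : ℕ} (hs : 2 ≤ s)
    (hsel : Nat.card ((congruentNumberCurve (∏ i, p i)).selmerGroup 2) = 2 ^ (2 + s)) :
    4 ∣ Fintype.card {v : Fin k ⊕ Fin k → ZMod 2 // monskyMatrixOdd p *ᵥ v = 0} := by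
  rw [monsky_card_selmerGroup_two_odd_holds k p hp hodd hinj] at hsel
  have hs' : monskySelmerRankOdd p = s := by
    have := Nat.pow_right_injective le_rfl hsel; omega
  rw [card_ker_mulVec_eq_pow, Fintype.card_sum, Fintype.card_fin, ← two_mul]
  rw [monskySelmerRankOdd] at hs'
  rw [hs']
  obtain ⟨t, rfl⟩ := Nat.exists_eq_add_of_le hs
  exact ⟨2 ^ t, by rw [pow_add]; norm_num⟩

include hp hodd hinj in
/-- **`κ_n = 0` for `s(n) ≥ 2`**: the sum of Monsky's kernel vanishes as soon as the kernel has order `≥ 4`.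
[cite: HeathBrown1994SelmerCongruentII, Appendix (Monsky), typescript p. 39 L27–L33] -/
theorem kappa_eq_zero_of_card_selmer {s : ℕ} (hs : 2 ≤ s)
    (hsel : Nat.card ((congruentNumberCurve (∏ i, p i)).selmerGroup 2) = 2 ^ (2 + s)) : kappa p = 0 := by
  rw [kappa]
  exact kerSum_eq_zero_of_four_dvd _ (four_dvd_card_ker_of_card_selmer p hp hodd hinj hs hsel)

end Kappa

/-! ## §3 The block sum as a quadratic form in `Ω`, and its vanishing for `κ = 0` -/

section BlockSum

variable {k : ℕ} (p : Fin k → ℕ) (hp : ∀ i, (p i).Prime) (hodd : ∀ i, Odd (p i)) (hinj : Function.Injective p)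

/-- `Ω_ba` as a sum over ALL blocks with the admissibility indicator. [cite: HeathBrown1994SelmerCongruentII, Appendix (Monsky), typescript p. 39 L27–L41] -/
theorem omega_eq_sum_ite (a b : Fin k) : Omega p b a =
    ∑ S : Finset (Fin k), (if (∏ l ∈ S, p l) % 8 = 5 then coblockWeight p S * blockRho p S b * (if a ∈ S then 1 else 0) else 0) := by
  rw [Omega, Matrix.of_apply, Finset.sum_filter]
  refine Finset.sum_congr rfl fun S _ => ?_
  by_cases hS : (∏ l ∈ S, p l) % 8 = 5
  · rw [if_pos ((admissible_eq_true_iff p S).mpr hS), if_pos hS]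
  · rw [if_neg (fun h => hS ((admissible_eq_true_iff p S).mp h)), if_neg hS]

/-- `Σ_b ρ_{S,b} x_b` over all `b` is the sum over the block (`ρ_{S,b} = 0` off `S`). [cite: HeathBrown1994SelmerCongruentII, Appendix (Monsky), typescript p. 39 L13–L26] -/
theorem sum_blockRho_mul_eq (S : Finset (Fin k)) (x : Fin k → ZMod 2) :
    (∑ b, blockRho p S b * x b) = ∑ b ∈ S, blockRho p S b * x b := by
  rw [← Finset.sum_filter_add_sum_filter_not univ (fun b => b ∈ S)]
  have hf : univ.filter (fun b => b ∈ S) = S := by ext b; simp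
  have hz : (∑ b ∈ univ.filter (fun b => ¬ b ∈ S), blockRho p S b * x b) = 0 :=
    Finset.sum_eq_zero fun b hb => by
      rw [mem_filter] at hb
      rw [blockRho_eq_zero_of_not_mem p S hb.2, zero_mul]
  rw [hf, hz, add_zero]

/-- The DIAGONAL Ω-sum as a block sum: `Σ_j Ω_jj x_j = Σ_{S adm} w_S Σ_{l∈S} ρ_{S,l} x_l`. [cite: HeathBrown1994SelmerCongruentII, Appendix (Monsky), typescript p. 39 L27–L41] -/
theorem sum_omega_diag_mul_eq (x : Fin k → ZMod 2) :
    (∑ j, Omega p j j * x j) =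
      ∑ S : Finset (Fin k), (if (∏ l ∈ S, p l) % 8 = 5 then coblockWeight p S * ∑ l ∈ S, blockRho p S l * x l else 0) := by
  conv_lhs => simp only [omega_eq_sum_ite p, Finset.sum_mul]
  rw [Finset.sum_comm]
  refine Finset.sum_congr rfl fun S _ => ?_
  by_cases hS : (∏ l ∈ S, p l) % 8 = 5
  · simp only [if_pos hS]
    rw [← sum_blockRho_mul_eq p S x, Finset.mul_sum]
    refine Finset.sum_congr rfl fun j _ => ?_
    by_cases hj : j ∈ S
    · rw [if_pos hj]; ring
    · rw [if_neg hj, blockRho_eq_zero_of_not_mem p S hj]; ring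
  · simp only [if_neg hS, zero_mul, Finset.sum_const_zero]

/-- The FULL Ω-sum as a block sum: `Σ_a Σ_b Ω_ba x_a x_b = Σ_{S adm} w_S (Σ_{l∈S} x_l)(Σ_{l∈S} ρ_{S,l} x_l)`.
[cite: HeathBrown1994SelmerCongruentII, Appendix (Monsky), typescript p. 39 L27–L41] -/
theorem sum_omega_mul_mul_eq (x : Fin k → ZMod 2) :
    (∑ a, ∑ b, Omega p b a * (x a * x b)) =
      ∑ S : Finset (Fin k), (if (∏ l ∈ S, p l) % 8 = 5 then
        coblockWeight p S * ((∑ l ∈ S, x l) * ∑ l ∈ S, blockRho p S l * x l) else 0) := by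
  conv_lhs => simp only [omega_eq_sum_ite p, Finset.sum_mul]
  rw [Finset.sum_congr rfl (fun a _ => Finset.sum_comm), Finset.sum_comm]
  refine Finset.sum_congr rfl fun S _ => ?_
  by_cases hS : (∏ l ∈ S, p l) % 8 = 5
  · simp only [if_pos hS]
    have hterm : ∀ a b : Fin k, coblockWeight p S * blockRho p S b * (if a ∈ S then (1 : ZMod 2) else 0) * (x a * x b) =
        (if a ∈ S then x a else 0) * (coblockWeight p S * (blockRho p S b * x b)) := by
      intro a b; split_ifs <;> ring
    simp only [hterm]
    rw [← Fintype.sum_mul_sum, Fintype.sum_ite_mem, ← Finset.mul_sum, sum_blockRho_mul_eq p S x]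
    ring
  · simp only [if_neg hS, zero_mul, Finset.sum_const_zero]

/-- **g7's block sum is the quadratic form `(1 + x_i)·Σ_j Ω_jj x_j + Σ_a Σ_b Ω_ba x_a x_b`.**
[cite: HeathBrown1994SelmerCongruentII, Appendix (Monsky), typescript p. 39 L27–L41] -/
theorem sum_blocks_eq_omega_form (xim : ZMod 2) (x : Fin k → ZMod 2) :
    (∑ S : Finset (Fin k), (if (∏ l ∈ S, p l) % 8 = 5 then
        coblockWeight p S * (1 + (xim + ∑ l ∈ S, x l)) * ∑ l ∈ S, blockRho p S l * x l else 0)) =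
      (1 + xim) * (∑ j, Omega p j j * x j) + ∑ a, ∑ b, Omega p b a * (x a * x b) := by
  rw [sum_omega_diag_mul_eq p x, sum_omega_mul_mul_eq p x, Finset.mul_sum, ← Finset.sum_add_distrib]
  refine Finset.sum_congr rfl fun S _ => ?_
  split_ifs <;> ring

include hp hodd hinj in
/-- **`κ = 0` ⟹ the block sum vanishes identically** (for `∏ pᵢ ≡ 5 (mod 8)`): by (★) `Ω_jj = κB_j = 0` and `Ω_ab + Ω_ba = 0`, so the quadratic
form is a sum over the fixed-point-free pairing `(a, b) ↔ (b, a)` of cancelling terms. [cite: HeathBrown1994SelmerCongruentII, Appendix (Monsky), typescript p. 39 L27–L41] [cite: Smith2016CongruentDensity, §2] -/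
theorem sum_blocks_eq_zero_of_kappa_eq_zero (h5 : (∏ i, p i) % 8 = 5) (hκ : kappa p = 0) (xim : ZMod 2) (x : Fin k → ZMod 2) :
    (∑ S : Finset (Fin k), (if (∏ l ∈ S, p l) % 8 = 5 then
        coblockWeight p S * (1 + (xim + ∑ l ∈ S, x l)) * ∑ l ∈ S, blockRho p S l * x l else 0)) = 0 := by
  obtain ⟨hdiag, hoff⟩ := qFormIdentityOmega k p hp hodd hinj h5
  have hA : ∀ i, kappaA p i = 0 := fun i => by rw [kappaA, hκ]; rfl
  have hB : ∀ i, kappaB p i = 0 := fun i => by rw [kappaB, hκ]; rfl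
  have hdiag0 : ∀ j, Omega p j j = 0 := fun j => by rw [hdiag j, hB j]
  have hsymm : ∀ a b, Omega p a b + Omega p b a = 0 := by
    intro a b
    by_cases hab : a = b
    · subst hab; rw [hdiag0]; decide
    · rw [hoff a b hab, hA, hB, hA, hB]; decide
  rw [sum_blocks_eq_omega_form p xim x]
  have h1 : (∑ j, Omega p j j * x j) = 0 := Finset.sum_eq_zero fun j _ => by rw [hdiag0 j, zero_mul]
  have h2 : (∑ a, ∑ b, Omega p b a * (x a * x b)) = 0 := by
    rw [← Finset.sum_product' (f := fun a b => Omega p b a * (x a * x b)), Finset.univ_product_univ]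
    refine Finset.sum_ninvolution (fun ab => (ab.2, ab.1)) (fun ab => ?_) (fun ab hne => ?_) (fun ab => mem_univ _)
      (fun ab => rfl)
    · have e : Omega p ab.2 ab.1 * (x ab.1 * x ab.2) + Omega p ab.1 ab.2 * (x ab.2 * x ab.1) =
          (Omega p ab.2 ab.1 + Omega p ab.1 ab.2) * (x ab.1 * x ab.2) := by ring
      rw [e, hsymm, zero_mul]
    · intro h
      apply hne
      have h12 : ab.1 = ab.2 := by simpa using congrArg Prod.snd h
      rw [← h12, hdiag0, zero_mul]
  rw [h1, h2, mul_zero, add_zero]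

end BlockSum

/-! ## §4 The genus point is fixed by every square of `Gal(ℍ′_n/ℚ)` when `s(n) ≥ 2` -/

section Main

variable {k : ℕ} (p : Fin k → ℕ) (hp : ∀ i, (p i).Prime) (hodd : ∀ i, Odd (p i)) (hinj : Function.Injective p)
variable {n : ℕ} (D : GenusPointData n)

include hp hodd hinj in
/-- **LAYER-1 SILENCE.**  `n = p₁⋯p_k ≡ 5 (mod 8)` square-free; the printed recursion and sign choices; the CM-point layer, conductor-2 ring class
dictionary and Frobenius clause on every block (displays); Thm 1.1; and `#Sel₂(E_n/ℚ) = 2^{2+s}` with `s ≥ 2` (e.g. the jump-one class `2⁵`).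
Then **every square `g² ∈ Gal(ℍ′_n/ℚ)` fixes `P(n)`**: `g²·P(n) = P(n)` for all `g`.  (At `s = 1` the LEAD g7 proved the opposite: a square mover
exists, `MoverAssembly.exists_sq_mover_of_card_selmer_eight`.)
[cite: TianYuanZhang2017, §3.1 (p0011 L53–L73), Prop. 3.2 (1), Thm. 3.6 (1), proof of Lemma 3.21 (p0020 L27–L63), Thm. 1.1]
[cite: HeathBrown1994SelmerCongruentII, Appendix (Monsky), typescript p. 39 L10–L41] [cite: Smith2016CongruentDensity, Thm. 1.2] -/
theorem galPt_sq_genusPoint_eq_of_card_selmer (hn : n = ∏ i, p i) (h5 : n % 8 = 5) (hrec : D.recursion) (hLs : D.scriptLSpec)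
    (z : ℕ → APoint D.H) (Φ : ℕ → Finset (D.H ≃ₐ[ℚ] D.H)) (ΓH ΓH' : ℕ → Subgroup (D.H ≃ₐ[ℚ] D.H))
    (σ : ℕ → (D.H ≃ₐ[ℚ] D.H)) (c : D.H ≃ₐ[ℚ] D.H) (ρ : (d : ℕ) → (D.galK d →* RingClassGroup (GenusField d) 2))
    (hc : D.ConjSpec c)
    (hblock : ∀ d ∈ n.divisors, ((d % 8 = 5 ∨ d % 8 = 6) → D.CMBlockSpec d (z d) (Φ d) (ΓH d) (ΓH' d) (σ d) c) ∧
      (d % 8 = 7 → D.SevenBlockSpec d))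
    (hring : ∀ d ∈ n.divisors, d % 8 = 5 → D.RingClassTwoBlockSpec d (ΓH d) (ΓH' d) (ρ d))
    (hFrob : ∀ d ∈ n.divisors, d % 8 = 5 → ∀ q : ℕ, q.Prime → q ∣ d → ∃ φ : D.H ≃ₐ[ℚ] D.H,
      φ (D.sqrtNeg d) = D.sqrtNeg d ∧ φ * φ ∈ ΓH' d ∧ φ D.im = (jacobiSym (-1) q) • D.im ∧
        ∀ r : ℕ, r.Prime → r ∣ n → r ≠ q → φ (D.sqrtNeg r) = (jacobiSym (-(r : ℤ)) q) • D.sqrtNeg r)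
    (h11 : thm11_parity_of_scriptL) {s : ℕ} (hs : 2 ≤ s)
    (hsel : Nat.card ((congruentNumberCurve n).selmerGroup 2) = 2 ^ (2 + s)) (g : D.H ≃ₐ[ℚ] D.H) :
    D.galPt (g * g) (D.P n) = D.P n := by
  have hprod : (∏ i, p i) % 8 = 5 := by rw [← hn]; exact h5
  have hsel' : Nat.card ((congruentNumberCurve (∏ i, p i)).selmerGroup 2) = 2 ^ (2 + s) := by rw [← hn]; exact hsel
  have hκ : kappa p = 0 := kappa_eq_zero_of_card_selmer p hp hodd hinj hs hsel'
  have key : ∀ (xim : ZMod 2) (x : Fin k → ZMod 2),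
      (∑ S : Finset (Fin k), (if (∏ l ∈ S, p l) % 8 = 5 then
        coblockWeight p S * (1 + (xim + ∑ l ∈ S, x l)) * ∑ l ∈ S, blockRho p S l * x l else 0)) = 0 :=
    sum_blocks_eq_zero_of_kappa_eq_zero p hp hodd hinj hprod hκ
  by_contra hne
  have h1 := (sqMover_iff_sum_blocks p hp hodd hinj D hn h5 hrec hLs z Φ ΓH ΓH' σ c ρ hc hblock hring hFrob h11 g).mp hne
  have h0 := key (if g D.im = D.im then (0 : ZMod 2) else 1)
    (fun i => if g (D.im * D.sqrtNeg (p i)) = D.im * D.sqrtNeg (p i) then (0 : ZMod 2) else 1)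
  beta_reduce at h0
  rw [h0] at h1
  exact zero_ne_one h1

include hp hodd hinj in
/-- **Layer-1 silence on the JUMP-ONE class** (`#Sel₂(E_n) = 2⁵`, the class of C⁺ = item 23431; `n ≡ 5 (mod 8)`): every square of
`Gal(ℍ′_n/ℚ)` fixes `P(n)`.  So the square-mover road to «`4 ∤ 𝓛(n)`» (`GaloisMotion.not_four_dvd_of_galPt_genusPoint_ne`) is closed there.
[cite: TianYuanZhang2017, §3.1 (p0011 L53–L73), Thm. 3.6 (1), proof of Lemma 3.21, Thm. 1.1] [cite: HeathBrown1994SelmerCongruentII, Appendix (Monsky), typescript p. 39 L10–L41] -/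
theorem galPt_sq_genusPoint_eq_of_card_selmer_thirtytwo (hn : n = ∏ i, p i) (h5 : n % 8 = 5) (hrec : D.recursion)
    (hLs : D.scriptLSpec)
    (z : ℕ → APoint D.H) (Φ : ℕ → Finset (D.H ≃ₐ[ℚ] D.H)) (ΓH ΓH' : ℕ → Subgroup (D.H ≃ₐ[ℚ] D.H))
    (σ : ℕ → (D.H ≃ₐ[ℚ] D.H)) (c : D.H ≃ₐ[ℚ] D.H) (ρ : (d : ℕ) → (D.galK d →* RingClassGroup (GenusField d) 2))
    (hc : D.ConjSpec c)
    (hblock : ∀ d ∈ n.divisors, ((d % 8 = 5 ∨ d % 8 = 6) → D.CMBlockSpec d (z d) (Φ d) (ΓH d) (ΓH' d) (σ d) c) ∧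
      (d % 8 = 7 → D.SevenBlockSpec d))
    (hring : ∀ d ∈ n.divisors, d % 8 = 5 → D.RingClassTwoBlockSpec d (ΓH d) (ΓH' d) (ρ d))
    (hFrob : ∀ d ∈ n.divisors, d % 8 = 5 → ∀ q : ℕ, q.Prime → q ∣ d → ∃ φ : D.H ≃ₐ[ℚ] D.H,
      φ (D.sqrtNeg d) = D.sqrtNeg d ∧ φ * φ ∈ ΓH' d ∧ φ D.im = (jacobiSym (-1) q) • D.im ∧
        ∀ r : ℕ, r.Prime → r ∣ n → r ≠ q → φ (D.sqrtNeg r) = (jacobiSym (-(r : ℤ)) q) • D.sqrtNeg r)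
    (h11 : thm11_parity_of_scriptL)
    (hsel : Nat.card ((congruentNumberCurve n).selmerGroup 2) = 2 ^ 5) (g : D.H ≃ₐ[ℚ] D.H) :
    D.galPt (g * g) (D.P n) = D.P n :=
  galPt_sq_genusPoint_eq_of_card_selmer p hp hodd hinj D hn h5 hrec hLs z Φ ΓH ΓH' σ c ρ hc hblock hring hFrob h11
    (s := 3) (by norm_num) (by rw [hsel]) g

end Main

end Summit.BirchSwinnertonDyer.PrintCf2.LayerOneSilence

end
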